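import Summits.ResolutionOfSingularities.ResolutionOfSingularities.Theorems.PurelyInseparableDim4ScopeCover
import HarnessLib

/-!
# MODE 1h has an infinite IN-SCOPE branch at `p = q = 2`: idea-2's spine SPECIMEN A ‖ K
# (cell `res-dim4-pi`, desk WORD #26 (i)(5) «LOCATED, CANDIDATE, K welcome»; frame v4 F4-C)

[OURS · counted 0] Nothing here is a statement about resolution of singularities.
The spine 3-cycle `t₁ = (x₁²x₂⁵x₃ + x₁⁵x₃⁶, (2,0,0,0), {x₁}) →[divisor x₁] t₂ = (x₂⁵x₃ + x₁³x₃⁶, 0, {x₁})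
→[line {x₁,x₂}] t₀ = (x₁x₃⁶ + x₁³x₂⁵x₃, (1,0,0,0), {x₁}) →[line {x₁,x₃}] t₁` (all `x₁`-charts, origins) is a
MODE-1h cycle (`StepKit.cycleB (h1B 2) 2 specA = true` by `decide`) and its three states are
`InCoordinateScope 2`: at `t₁`, `t₂` the ideal `J₂⁺ = ⟨∂ᵢF⟩` is MONOMIAL (`ScopeCover.scopeTermsB … = true` by
`decide`); at `t₀` (`∂₁t₀ = x₃⁶ + x₁²x₂⁵x₃`) every prime over `J₂⁺` inside `𝔪₀` contains `x₃` and `x₁` or `x₂`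
and then the generators inside its coordinate hull (`inCoordinateScope_t0`, via
`ScopeCover.inCoordinateScope_of_forall_prime`).  Hence **`exists_step1h_chain_inCoordinateScope_two`**: an
infinite MODE-1h branch over `𝔽₂` all of whose states are in coordinate scope — cardinality-first rules are
no witnesses for F4-C `TerminatesInScope 2 2` (as the point rule is not: `…ScopeCover`), so F4-C's `∃R`
must win the spine game.  Specimen found by res-dim4-idea-2 (16:37:07Z, hand + script); kernel here.
OURS; counted 0.  bears_on: LADDER-RESOLUTION:D157-DOOR2 (res-dim4-pi · frame v4 F4-C).
Supports stmt-ResolutionOfSingularities-16155 (helper).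
-/

set_option linter.dupNamespace false -- mandated namespace of this single-conjunct summit

noncomputable section

open MvPolynomial Finset

namespace Summit.ResolutionOfSingularities.ResolutionOfSingularities.Theorems.PIDim4

namespace ScopeCover

open StepKit
open Literature.AlgebraicGeometry.Resolution
open Literature.AlgebraicGeometry.Resolution.CentreBlowup


/-- `t₁ = (x₁²x₂⁵x₃ + x₁⁵x₃⁶, (2,0,0,0), {x₁})`. [folklore] -/
def t1 : SData 4 (ZMod 2) := ⟨[(![2, 5, 1, 0], 1), (![5, 0, 6, 0], 1)], ![2, 0, 0, 0], {0}⟩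
/-- `t₂ = (x₂⁵x₃ + x₁³x₃⁶, 0, {x₁})`. [folklore] -/
def t2 : SData 4 (ZMod 2) := ⟨[(![0, 5, 1, 0], 1), (![3, 0, 6, 0], 1)], ![0, 0, 0, 0], {0}⟩
/-- `t₀ = (x₁x₃⁶ + x₁³x₂⁵x₃, (1,0,0,0), {x₁})`. [folklore] -/
def t0 : SData 4 (ZMod 2) := ⟨[(![1, 0, 6, 0], 1), (![3, 5, 1, 0], 1)], ![1, 0, 0, 0], {0}⟩

/-- The specimen-A cycle rows: `t₁ →[x₁] t₂ →[{x₁,x₂}] t₀ →[{x₁,x₃}] t₁`, `x₁`-charts, origins. [folklore] -/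
def specA : List (CycRow (ZMod 2)) :=
  [(t1, {0}, 0, ![0, 0, 0, 0]), (t2, {0, 1}, 0, ![0, 0, 0, 0]), (t0, {0, 2}, 0, ![0, 0, 0, 0])]

/-- The rows check in MODE 1h. -/
theorem cycleB_specA : cycleB (h1B 2) 2 specA = true := by decide

/-- `t₁` is in scope (`J₂⁺` monomial: `x₁⁴x₃⁶, x₁²x₂⁴x₃, x₁²x₂⁵`). -/
theorem inCoordinateScope_t1 : InCoordinateScope 2 t1.toState.F := inCoordinateScope_of_scopeTermsB (by decide)

/-- `t₂` is in scope (`J₂⁺` monomial: `x₁²x₃⁶, x₂⁴x₃, x₂⁵`). -/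
theorem inCoordinateScope_t2 : InCoordinateScope 2 t2.toState.F := inCoordinateScope_of_scopeTermsB (by decide)

/-- A non-zero term in a prime `P ≤ 𝔪₀` has a variable in `P`. [folklore] -/
theorem exists_X_mem_of_monomial_mem {K : Type} [Field K] {P : Ideal (MvPolynomial (Fin 4) K)} (hP : P.IsPrime)
    (hP0 : P ≤ originIdeal K) {m : Fin 4 →₀ ℕ} {c : K} (hc : c ≠ 0) (hm : monomial m c ∈ P) :
    ∃ i, 0 < m i ∧ (X i : MvPolynomial (Fin 4) K) ∈ P := by
  have h := monomial_mem_span_varsOf hP hP0 hm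
  obtain ⟨i, hi, hmi⟩ := (MvPolynomial.mem_ideal_span_X_image.mp h) m (by
    rw [MvPolynomial.mem_support_iff, coeff_monomial, if_pos rfl]; exact hc)
  exact ⟨i, Nat.pos_of_ne_zero hmi, hi⟩

/-- `∂₁t₀ = x₃⁶ + x₁²x₂⁵x₃` on term lists. -/
theorem hasseL_t0_0 : evalT (hasseL (Pi.single 0 1) t0.L) = evalT [(![0, 0, 6, 0], (1 : ZMod 2)), (![2, 5, 1, 0], 1)] :=
  (evalT_eq_iff_equivB _ _).mpr (by decide)
/-- `∂₂t₀ = x₁³x₂⁴x₃`. -/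
theorem hasseL_t0_1 : evalT (hasseL (Pi.single 1 1) t0.L) = evalT [(![3, 4, 1, 0], (1 : ZMod 2))] :=
  (evalT_eq_iff_equivB _ _).mpr (by decide)
/-- `∂₃t₀ = x₁³x₂⁵`. -/
theorem hasseL_t0_2 : evalT (hasseL (Pi.single 2 1) t0.L) = evalT [(![3, 5, 0, 0], (1 : ZMod 2))] :=
  (evalT_eq_iff_equivB _ _).mpr (by decide)
/-- `∂₄t₀ = 0`. -/
theorem hasseL_t0_3 : evalT (hasseL (Pi.single 3 1) t0.L) = evalT ([] : Terms 4 (ZMod 2)) :=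
  (evalT_eq_iff_equivB _ _).mpr (by decide)

/-- `x₃⁶ + x₁²x₂⁵x₃ = x₃·(x₃⁵ + x₁²x₂⁵)`. -/
theorem evalT_A_eq : evalT [(![0, 0, 6, 0], (1 : ZMod 2)), (![2, 5, 1, 0], 1)] =
    (X 2 * (X 2 ^ 5 + X 0 ^ 2 * X 1 ^ 5) : MvPolynomial (Fin 4) (ZMod 2)) := by
  simp only [evalT_cons, evalT_nil, add_zero, monomial_expo_eq, Fin.prod_univ_four]
  simp; ring
/-- `x₁³x₂⁴x₃ = (x₁³x₂⁴)·x₃`. -/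
theorem evalT_B_eq : evalT [(![3, 4, 1, 0], (1 : ZMod 2))] = ((X 0 ^ 3 * X 1 ^ 4) * X 2 : MvPolynomial (Fin 4) (ZMod 2)) := by
  simp only [evalT_cons, evalT_nil, add_zero, monomial_expo_eq, Fin.prod_univ_four]
  simp
/-- `x₁³x₂⁵` as a product. -/
theorem evalT_C_eq : evalT [(![3, 5, 0, 0], (1 : ZMod 2))] = (X 0 ^ 3 * X 1 ^ 5 : MvPolynomial (Fin 4) (ZMod 2)) := by
  simp only [evalT_cons, evalT_nil, add_zero, monomial_expo_eq, Fin.prod_univ_four]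
  simp

/-- The generator `D^{(eᵢ)} t₀` on term lists (bridge `⇑(single i 1) = Pi.single i 1`). -/
theorem hasseDeriv_t0 (i : Fin 4) :
    hasseDeriv (Finsupp.single i 1) t0.toState.F = evalT (hasseL (Pi.single i 1) t0.L) := by
  rw [SData.toState_F, ← expo_coe (Finsupp.single i 1), hasseDeriv_evalT, Finsupp.single_eq_pi_single]

/-- **`t₀` is in scope**: every prime over `J₂⁺(t₀)` inside `𝔪₀` contains `x₃` and `x₁` or `x₂`, hence
the three generators inside its coordinate hull. -/
theorem inCoordinateScope_t0 : InCoordinateScope 2 t0.toState.F := by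
  refine inCoordinateScope_of_forall_prime fun P hP hJP hP0 => ?_
  have hgen : ∀ i : Fin 4, evalT (hasseL (Pi.single i 1) t0.L) ∈ P := fun i => by
    rw [← hasseDeriv_t0]
    exact hJP (Ideal.subset_span ⟨Finsupp.single i 1, by rw [Finsupp.degree_single]; omega,
      by rw [Finsupp.degree_single]; omega, rfl⟩)
  have h01 : (X 0 : MvPolynomial (Fin 4) (ZMod 2)) ∈ P ∨ (X 1 : MvPolynomial (Fin 4) (ZMod 2)) ∈ P := by
    have h := hgen 2
    rw [hasseL_t0_2, evalT_cons, evalT_nil, add_zero] at h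
    obtain ⟨i, hi, hXi⟩ := exists_X_mem_of_monomial_mem hP hP0 one_ne_zero h
    fin_cases i
    · exact Or.inl hXi
    · exact Or.inr hXi
    · simp at hi
    · simp at hi
  have hx15 : (X 0 ^ 2 * X 1 ^ 5 : MvPolynomial (Fin 4) (ZMod 2)) ∈ P := by
    rcases h01 with h0 | h0
    · exact P.mul_mem_right _ (P.pow_mem_of_mem h0 2 (by norm_num))
    · exact P.mul_mem_left _ (P.pow_mem_of_mem h0 5 (by norm_num))
  have hX2 : (X 2 : MvPolynomial (Fin 4) (ZMod 2)) ∈ P := by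
    have h := hgen 0
    rw [hasseL_t0_0, evalT_A_eq] at h
    rcases hP.mem_or_mem h with h | h
    · exact h
    · have h5 : (X 2 ^ 5 : MvPolynomial (Fin 4) (ZMod 2)) ∈ P := by
        have := P.sub_mem h hx15; rwa [add_sub_cancel_right] at this
      exact hP.mem_of_pow_mem 5 h5
  have hull2 : (X 2 : MvPolynomial (Fin 4) (ZMod 2)) ∈
      Ideal.span ((fun i => (X i : MvPolynomial (Fin 4) (ZMod 2))) '' varsOf P) := Ideal.subset_span ⟨2, hX2, rfl⟩
  have hullC : (X 0 ^ 3 * X 1 ^ 5 : MvPolynomial (Fin 4) (ZMod 2)) ∈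
      Ideal.span ((fun i => (X i : MvPolynomial (Fin 4) (ZMod 2))) '' varsOf P) := by
    rcases h01 with h0 | h0
    · have hull0 : (X 0 : MvPolynomial (Fin 4) (ZMod 2)) ∈
          Ideal.span ((fun i => (X i : MvPolynomial (Fin 4) (ZMod 2))) '' varsOf P) := Ideal.subset_span ⟨0, h0, rfl⟩
      exact Ideal.mul_mem_right _ _ (Ideal.pow_mem_of_mem _ hull0 3 (by norm_num))
    · have hull1 : (X 1 : MvPolynomial (Fin 4) (ZMod 2)) ∈
          Ideal.span ((fun i => (X i : MvPolynomial (Fin 4) (ZMod 2))) '' varsOf P) := Ideal.subset_span ⟨1, h0, rfl⟩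
      exact Ideal.mul_mem_left _ _ (Ideal.pow_mem_of_mem _ hull1 5 (by norm_num))
  unfold singLocusIdeal
  rw [Ideal.span_le]
  rintro G ⟨α, h0, hq, rfl⟩
  obtain ⟨i, rfl⟩ := IsolationCert.exists_eq_single_of_degree_eq_one (γ := α) (by omega)
  rw [SetLike.mem_coe, hasseDeriv_t0]
  fin_cases i
  · rw [show (⟨0, by norm_num⟩ : Fin 4) = 0 from rfl, hasseL_t0_0, evalT_A_eq]; exact Ideal.mul_mem_right _ _ hull2
  · rw [show (⟨1, by norm_num⟩ : Fin 4) = 1 from rfl, hasseL_t0_1, evalT_B_eq]; exact Ideal.mul_mem_left _ _ hull2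
  · rw [show (⟨2, by norm_num⟩ : Fin 4) = 2 from rfl, hasseL_t0_2, evalT_C_eq]; exact hullC
  · rw [show (⟨3, by norm_num⟩ : Fin 4) = 3 from rfl, hasseL_t0_3, evalT_nil]; exact Ideal.zero_mem _

/-- **MODE 1h has an infinite IN-SCOPE branch at `p = q = 2`** (idea-2 SPECIMEN A ‖ K): an infinite
MODE-1h chain over `𝔽₂` every state of which is `InCoordinateScope 2`. [folklore] -/
theorem exists_step1h_chain_inCoordinateScope_two :
    ∃ c : ℕ → State (ZMod 2), ∀ k, InCoordinateScope 2 (c k).F ∧ Step1h 2 (c k) (c (k + 1)) := by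
  have hlen : 0 < specA.length := by simp [specA]
  refine ⟨fun k => (cyc specA (t1, {0}, 0, ![0, 0, 0, 0]) k).1.toState, fun k => ⟨?_, ?_⟩⟩
  · have hmem : cyc specA (t1, {0}, 0, ![0, 0, 0, 0]) k ∈ specA := by
      unfold cyc
      rw [List.getD_eq_getElem?_getD, List.getElem?_eq_getElem (Nat.mod_lt _ hlen), Option.getD_some]
      exact List.getElem_mem _
    show InCoordinateScope 2 (cyc specA (t1, {0}, 0, ![0, 0, 0, 0]) k).1.toState.F
    generalize cyc specA (t1, {0}, 0, ![0, 0, 0, 0]) k = x at hmem ⊢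
    simp only [specA, List.mem_cons, List.not_mem_nil, or_false] at hmem
    rcases hmem with rfl | rfl | rfl
    · exact inCoordinateScope_t1
    · exact inCoordinateScope_t2
    · exact inCoordinateScope_t0
  · exact chain_of_cyclic (fun r r' : CycRow (ZMod 2) => Step1h 2 r.1.toState r'.1.toState) specA _
      (by simp [specA]) (fun i hi => by
        have hall := cycleB_specA
        simp only [cycleB, Bool.and_eq_true, Bool.not_eq_true', List.all_eq_true, List.mem_range] at hall
        have h := hall.2 i hi
        rw [List.getElem?_eq_getElem hi, List.getElem?_eq_getElem (Nat.mod_lt _ hlen)] at h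
        obtain ⟨hc, hedge⟩ := edge_of_rowB h
        exact ⟨_, (isMode1hCentre_iff 2 _ _).mpr hc, hedge⟩) k

/-- Hence a MODE-1h-following rule is no witness for `TerminatesInScope 2 2`, just as the point rule is not
(`exists_stepRule_point_chain_inCoordinateScope`): F4-C's rule must beat the spine game. [folklore] -/
theorem exists_step2_chain_inCoordinateScope_two :
    ∃ c : ℕ → State (ZMod 2), ∀ k, InCoordinateScope 2 (c k).F ∧ Step2 2 (c k) (c (k + 1)) := by
  obtain ⟨c, hc⟩ := exists_step1h_chain_inCoordinateScope_two
  exact ⟨c, fun k => ⟨(hc k).1, by obtain ⟨S, hS, hE⟩ := (hc k).2; exact ⟨S, hS.1, hE⟩⟩⟩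

end ScopeCover

end Summit.ResolutionOfSingularities.ResolutionOfSingularities.Theorems.PIDim4

end
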